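import Mathlib.RingTheory.Norm.Basic
import Literature.NumberTheory.EllipticCurves.TwoDescent
import HarnessLib

/-!
# Square classes are injective under odd-degree field extensions (Springer's theorem in rank one; proofs only)

For a finite extension of fields `F/K` of ODD degree, an element of `K` that becomes a square in `F` is already a square in `K`:
taking norms, `k^{[F:K]} = N_{F/K}(f)²`, and an odd power of `k` being a square forces `k` to be one.  Equivalently the natural map
`K^×/K^{×2} → F^×/F^{×2}` (restriction `H¹(K, μ₂) → H¹(F, μ₂)`) is INJECTIVE.  This is the one-dimensional case of Springer's theorem
(anisotropic quadratic forms stay anisotropic under odd-degree extensions: the binary form `⟨1, −k⟩`).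

* `isSquare_of_isSquare_algebraMap_of_odd_finrank` — the statement for `IsSquare`;
* `sqClass_eq_one_of_algebraMap` / `sqClass_algebraMap_injective` — the same in the tree's square-class vocabulary
  (`WeierstrassCurve.Affine.sqClass : F → Fˣ/Fˣ²` of `Literature/NumberTheory/EllipticCurves/TwoDescent.lean`).

Use (prover's note, crux stmt-BirchSwinnertonDyer-20509): the ODD-degree step when reading the Kummer / `2`-descent class of a Galois trace over an
intermediate field — complementary to the quadratic (involution) step `TwoDescentGaloisNormProofs` (the `2`-descent classes of `P + σP` over the fixed
field are norms); along an abelian tower the two steps cover every layer.  PROOFS ONLY: no `def`, no named fact.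

References: [cite: Lam2005, Ch. VII Thm. 2.7 (Springer's theorem; the binary form ⟨1, −a⟩)]; [cite: NeukirchSchmidtWingberg2008, Cor. 1.5.7 (res injective on the prime-to-[F:K] part; cor ∘ res = [F:K])].
-/

noncomputable section

namespace Literature.FieldTheory.Kummer

open WeierstrassCurve.Affine

variable {K F : Type*} [Field K] [Field F] [Algebra K F] [FiniteDimensional K F]

/-- **Springer's theorem in rank one**: if `[F : K]` is odd and `k ∈ K` becomes a square in `F`, then `k` is a square in `K`
(`k^{[F:K]} = N_{F/K}(f)²` with `[F:K] = 2m + 1` gives `k = (N(f)/k^m)²`). [cite: Lam2005, Ch. VII Thm. 2.7] -/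
theorem isSquare_of_isSquare_algebraMap_of_odd_finrank (hodd : Odd (Module.finrank K F)) {k : K}
    (h : IsSquare (algebraMap K F k)) : IsSquare k := by
  by_cases hk : k = 0
  · exact ⟨0, by rw [hk, mul_zero]⟩
  obtain ⟨f, hf⟩ := h
  obtain ⟨m, hm⟩ := hodd
  have hN : Algebra.norm K (algebraMap K F k) = k ^ Module.finrank K F := Algebra.norm_algebraMap k
  rw [hf, map_mul, hm] at hN
  -- `N(f)² = k^(2m+1)`, so `k = (N(f) / k^m)²`
  refine ⟨Algebra.norm K f / k ^ m, ?_⟩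
  have hkm : k ^ m ≠ 0 := pow_ne_zero m hk
  field_simp
  linear_combination -hN

/-- **In square-class vocabulary**: for `[F : K]` odd and `k ≠ 0`, `[k] = 1` in `F^×/F^{×2}` (after base change) implies `[k] = 1` in `K^×/K^{×2}`.
[cite: Lam2005, Ch. VII Thm. 2.7] -/
theorem sqClass_eq_one_of_algebraMap (hodd : Odd (Module.finrank K F)) {k : K} (hk : k ≠ 0)
    (h : sqClass (algebraMap K F k) = 1) : sqClass k = 1 := by
  have hk' : algebraMap K F k ≠ 0 := (map_ne_zero _).mpr hk
  obtain ⟨u, hu⟩ := (sqClass_eq_one_iff hk').mp h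
  obtain ⟨r, hr⟩ := isSquare_of_isSquare_algebraMap_of_odd_finrank hodd ⟨u, by rw [hu, pow_two]⟩
  exact (sqClass_eq_one_iff hk).mpr ⟨r, by rw [hr, pow_two]⟩

/-- **`K^×/K^{×2} → F^×/F^{×2}` is injective for `[F : K]` odd** (on classes of non-zero elements): equal classes in `F` imply equal classes
in `K`.  (Restriction `H¹(K, μ₂) → H¹(F, μ₂)` is injective since `cor ∘ res = [F:K]` is odd.)
[cite: Lam2005, Ch. VII Thm. 2.7] [cite: NeukirchSchmidtWingberg2008, Cor. 1.5.7] -/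
theorem sqClass_algebraMap_injective (hodd : Odd (Module.finrank K F)) {k₁ k₂ : K} (hk₁ : k₁ ≠ 0) (hk₂ : k₂ ≠ 0)
    (h : sqClass (algebraMap K F k₁) = sqClass (algebraMap K F k₂)) : sqClass k₁ = sqClass k₂ := by
  have hk₁' : algebraMap K F k₁ ≠ 0 := (map_ne_zero _).mpr hk₁
  have hk₂' : algebraMap K F k₂ ≠ 0 := (map_ne_zero _).mpr hk₂
  -- `[k₁ k₂] = 1` in `F`, hence in `K`
  have hprodF : sqClass (algebraMap K F (k₁ * k₂)) = 1 := by
    rw [map_mul, sqClass_mul hk₁' hk₂', h, SqUnits.mul_self]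
  have hprodK : sqClass (k₁ * k₂) = 1 := sqClass_eq_one_of_algebraMap hodd (mul_ne_zero hk₁ hk₂) hprodF
  rw [sqClass_mul hk₁ hk₂] at hprodK
  rw [SqUnits.eq_mul_of_mul_eq hprodK, SqUnits.one_mul]

end Literature.FieldTheory.Kummer

end
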